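import Literature.Analysis.OperatorTheory.KreinStewartAbstract

/-!
# Kreĭn–Stewart definitization: difference quotients and the translation form of `F`

(1) For a smooth `g : ℝ → ℂ`, the iterated symmetric difference quotients `(SD η)^[N] g s'`
converge to `g^{(N)}(s)` as `η → 0⁺`, `s' → s` (`KreinStewart.SD_iterate_approx`), by induction on
`N` through the integral representation `SD η g u = ½ ∫_{-1}^{1} g'(u + ηθ) dθ` — the analytic
input replacing the integrations by parts against test functions in Stewart 1972, Thm. 3.1.

(2) Properties of `KreinStewart.BF F` (`Σ_s Σ_t conj(x s) y t F(t - s)` on `ℝ →₀ ℂ`): Hermitian when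
`F(-x) = conj F(x)`, translations `U a` are unitary, the difference-quotient operators
`SDOp η = (2iη)⁻¹ (U η - U (-η))` are symmetric and act on `u ↦ BF δ_u x` as `i · SD η`, the matrix
entries `BF δ_s ((SDOp η)^N δ_t)` tend to `(-i)^N F^{(N)}(t - s)` as `η → 0⁺`, and `BF F` has at most
`κ` negative squares when the point-mass forms of `F` do (Stewart 1972, §1 and Thm. 2.4).
See `KreinStewartDefs` for the overview.
-/

section Differences

open scoped ComplexConjugate ContDiff
open intervalIntegral

namespace Literature.Analysis.OperatorTheory.KreinStewart

/-- `SD` preserves continuity. [folklore] -/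
theorem continuous_SD {η : ℝ} {f : ℝ → ℂ} (hf : Continuous f) : Continuous (SD η f) := by
  unfold SD
  fun_prop

/-- Iterates of `SD` preserve continuity. [folklore] -/
theorem continuous_SD_iterate {η : ℝ} (N : ℕ) {f : ℝ → ℂ} (hf : Continuous f) :
    Continuous ((SD η)^[N] f) := by
  induction N generalizing f with
  | zero => simpa using hf
  | succ N ih =>
    rw [Function.iterate_succ_apply]
    exact ih (continuous_SD hf)

/-- `SD` is linear: constants factor out. [folklore] -/
theorem SD_const_mul (η : ℝ) (a : ℂ) (f : ℝ → ℂ) :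
    SD η (fun u => a * f u) = fun u => a * SD η f u := by
  funext u
  simp only [SD]
  ring

/-- Shape of the iterated symmetric difference quotient: a finite combination of translates.
[folklore] -/
theorem SD_iterate_shape (N : ℕ) : ∃ (ι : Type) (_ : Fintype ι) (a : ι → ℂ) (b : ι → ℝ),
    ∀ (f : ℝ → ℂ) (η u : ℝ), η ≠ 0 →
      (SD η)^[N] f u = ∑ i, a i / (η : ℂ) ^ N * f (u + b i * η) := by
  induction N with
  | zero =>
    exact ⟨Unit, inferInstance, fun _ => 1, fun _ => 0, fun f η u _ => by simp⟩
  | succ N ih =>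
    obtain ⟨ι, _, a, b, h⟩ := ih
    refine ⟨ι ⊕ ι, inferInstance, Sum.elim (fun i => a i / 2) (fun i => -(a i / 2)),
      Sum.elim (fun i => b i + 1) (fun i => b i - 1), fun f η u hη => ?_⟩
    have hη' : (η : ℂ) ≠ 0 := Complex.ofReal_ne_zero.2 hη
    rw [Function.iterate_succ_apply, h _ _ _ hη, Fintype.sum_sum_type, ← Finset.sum_add_distrib]
    refine Finset.sum_congr rfl fun i _ => ?_
    simp only [Sum.elim_inl, Sum.elim_inr, SD]
    rw [show u + (b i + 1) * η = u + b i * η + η by ring,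
      show u + (b i - 1) * η = u + b i * η - η by ring]
    field_simp
    ring

/-- Integral representation of the symmetric difference quotient of a `C¹` function. [folklore] -/
theorem SD_eq_integral {g : ℝ → ℂ} (hg : ContDiff ℝ ∞ g) {η : ℝ} (hη : η ≠ 0) (u : ℝ) :
    SD η g u = (1 / 2 : ℂ) * ∫ θ in (-1 : ℝ)..1, deriv g (u + η * θ) := by
  have hcomp : ∫ θ in (-1 : ℝ)..1, deriv g (u + η * θ)
      = η⁻¹ • ∫ x in (u + η * (-1))..(u + η * 1), deriv g x :=
    integral_comp_add_mul (fun x => deriv g x) hη u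
  have hdiff : Differentiable ℝ g := hg.differentiable (by simp)
  have hftc : ∫ x in (u + η * (-1))..(u + η * 1), deriv g x = g (u + η * 1) - g (u + η * (-1)) :=
    integral_deriv_eq_sub (fun x _ => hdiff.differentiableAt)
      ((hg.continuous_deriv (by simp)).intervalIntegrable _ _)
  rw [hcomp, hftc, SD, mul_one, mul_neg_one, ← sub_eq_add_neg, Complex.real_smul,
    Complex.ofReal_inv]
  have hη' : (η : ℂ) ≠ 0 := Complex.ofReal_ne_zero.2 hη
  field_simp

/-- Iterated `SD` commutes with the integral representation. [folklore] -/
theorem SD_iterate_integral (N : ℕ) {h : ℝ → ℂ} (hh : Continuous h) {η : ℝ} (hη : η ≠ 0)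
    (s : ℝ) :
    (SD η)^[N] (fun u => (1 / 2 : ℂ) * ∫ θ in (-1 : ℝ)..1, h (u + η * θ)) s
      = (1 / 2 : ℂ) * ∫ θ in (-1 : ℝ)..1, (SD η)^[N] h (s + η * θ) := by
  obtain ⟨ι, _, a, b, hs⟩ := SD_iterate_shape N
  rw [hs _ _ _ hη]
  simp_rw [hs h η _ hη]
  rw [integral_finsetSum, Finset.mul_sum]
  · refine Finset.sum_congr rfl fun i _ => ?_
    rw [integral_const_mul]
    have : (fun θ : ℝ => h (s + η * θ + b i * η)) = fun θ => h (s + b i * η + η * θ) := by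
      funext θ
      rw [add_right_comm]
    rw [this]
    ring
  · intro i _
    apply Continuous.intervalIntegrable
    fun_prop

/-- **Convergence of iterated symmetric difference quotients**, locally uniformly in the base
point: `(SD η)^[N] g s' → g^{(N)}(s)` as `η → 0⁺`, `s' → s`, for smooth `g`. [folklore] -/
theorem SD_iterate_approx (N : ℕ) : ∀ (g : ℝ → ℂ), ContDiff ℝ ∞ g → ∀ (s ε : ℝ), 0 < ε →
    ∃ δ > 0, ∀ η s' : ℝ, 0 < η → η < δ → |s' - s| < δ →
      ‖(SD η)^[N] g s' - iteratedDeriv N g s‖ ≤ ε := by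
  induction N with
  | zero =>
    intro g hg s ε hε
    have hc : ContinuousAt g s := hg.continuous.continuousAt
    rw [Metric.continuousAt_iff] at hc
    obtain ⟨δ, hδ, hδ'⟩ := hc ε hε
    refine ⟨δ, hδ, fun η s' _ _ hs' => ?_⟩
    rw [Function.iterate_zero_apply, iteratedDeriv_zero]
    have := hδ' (x := s') (by rwa [Real.dist_eq])
    rw [dist_eq_norm] at this
    exact this.le
  | succ N ih =>
    intro g hg s ε hε
    have hg' : ContDiff ℝ ∞ (deriv g) := (contDiff_infty_iff_deriv.mp hg).2
    obtain ⟨δ₁, hδ₁, hδ₁'⟩ := ih (deriv g) hg' s ε hε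
    refine ⟨δ₁ / 2, by positivity, fun η s' hη hηδ hs' => ?_⟩
    have hη0 : η ≠ 0 := hη.ne'
    have hSD : SD η g = fun u => (1 / 2 : ℂ) * ∫ θ in (-1 : ℝ)..1, deriv g (u + η * θ) := by
      funext u
      exact SD_eq_integral hg hη0 u
    rw [Function.iterate_succ_apply, hSD, SD_iterate_integral N (hg'.continuous) hη0,
      iteratedDeriv_succ']
    set L := iteratedDeriv N (deriv g) s with hL
    have hint : IntervalIntegrable (fun θ : ℝ => (SD η)^[N] (deriv g) (s' + η * θ))
        MeasureTheory.volume (-1 : ℝ) 1 := by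
      apply Continuous.intervalIntegrable
      exact (continuous_SD_iterate N hg'.continuous).comp (by fun_prop)
    have hrepr : (1 / 2 : ℂ) * (∫ θ in (-1 : ℝ)..1, (SD η)^[N] (deriv g) (s' + η * θ)) - L
        = (1 / 2 : ℂ) * ∫ θ in (-1 : ℝ)..1, ((SD η)^[N] (deriv g) (s' + η * θ) - L) := by
      rw [integral_sub hint intervalIntegrable_const, integral_const]
      simp only [sub_neg_eq_add, Complex.real_smul]
      norm_num
      ring
    rw [hrepr, norm_mul, show ‖(1 / 2 : ℂ)‖ = 1 / 2 by norm_num]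
    have hbound : ∀ θ ∈ Set.uIoc (-1 : ℝ) 1, ‖(SD η)^[N] (deriv g) (s' + η * θ) - L‖ ≤ ε := by
      intro θ hθ
      rw [Set.uIoc_of_le (by norm_num : (-1 : ℝ) ≤ 1), Set.mem_Ioc] at hθ
      apply hδ₁' η (s' + η * θ) hη (by linarith)
      have hθ1 : |θ| ≤ 1 := abs_le.2 ⟨hθ.1.le, hθ.2⟩
      have hηθ : η * |θ| ≤ η := mul_le_of_le_one_right hη.le hθ1
      calc |s' + η * θ - s| = |(s' - s) + η * θ| := by ring_nf
        _ ≤ |s' - s| + |η * θ| := abs_add_le _ _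
        _ = |s' - s| + η * |θ| := by rw [abs_mul, abs_of_pos hη]
        _ < δ₁ / 2 + δ₁ / 2 := by linarith
        _ = δ₁ := by ring
    have hI := norm_integral_le_of_norm_le_const hbound
    calc 1 / 2 * ‖∫ θ in (-1 : ℝ)..1, ((SD η)^[N] (deriv g) (s' + η * θ) - L)‖
        ≤ 1 / 2 * (ε * |1 - (-1)|) := by gcongr
      _ = ε := by rw [show |(1 : ℝ) - -1| = 2 by norm_num]; ring

end Literature.Analysis.OperatorTheory.KreinStewart

end Differences

open scoped ComplexConjugate ContDiff
open Module Polynomial Filter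
open _root_.Topology

namespace Literature.Analysis.OperatorTheory.KreinStewart

section Form

variable (F : ℝ → ℂ)

/-- `BF` evaluated against a point mass. [folklore] -/
theorem BF_single_left (s : ℝ) (x : ℝ →₀ ℂ) :
    BF F (Finsupp.single s 1) x = ∑ t ∈ x.support, x t * F (t - s) := by
  rw [BF_apply, kf_eq F Finsupp.support_single_subset subset_rfl, Finset.sum_singleton]
  refine Finset.sum_congr rfl fun t _ => ?_
  rw [Finsupp.single_eq_same, map_one, one_mul]

/-- The Gram matrix of point masses is `F(t - s)`. [folklore] -/
theorem BF_single_single (s t : ℝ) :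
    BF F (Finsupp.single s 1) (Finsupp.single t 1) = F (t - s) := by
  rw [BF_single_left, Finsupp.support_single t one_ne_zero, Finset.sum_singleton,
    Finsupp.single_eq_same, one_mul]

variable {F}

/-- `BF` is Hermitian when `F(-x) = conj F(x)`. [folklore] -/
theorem isSymm_BF (hF : ∀ x, F (-x) = conj (F x)) : (BF F).IsSymm := by
  refine ⟨fun x y => ?_⟩
  rw [BF_apply, BF_apply, kf, kf, map_sum, Finset.sum_comm]
  refine Finset.sum_congr rfl fun t _ => ?_
  rw [map_sum]
  refine Finset.sum_congr rfl fun s _ => ?_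
  rw [map_mul, map_mul, Complex.conj_conj, ← hF, neg_sub]
  ring

variable (F)

/-- Translation of a point mass. [folklore] -/
theorem U_single (a s : ℝ) (b : ℂ) : U a (Finsupp.single s b) = Finsupp.single (s + a) b := by
  rw [U, Finsupp.lmapDomain_apply, Finsupp.mapDomain_single]

/-- Translations are unitary for `BF`: `BF (U a x) y = BF x (U (-a) y)`. [folklore] -/
theorem BF_U (a : ℝ) (x y : ℝ →₀ ℂ) : BF F (U a x) y = BF F x (U (-a) y) := by
  classical
  have hinj : ∀ b : ℝ, Function.Injective fun s : ℝ => s + b := fun b => add_left_injective b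
  rw [BF_apply, BF_apply, U, U, Finsupp.lmapDomain_apply, Finsupp.lmapDomain_apply,
    kf_eq F Finsupp.mapDomain_support subset_rfl, kf_eq F subset_rfl Finsupp.mapDomain_support,
    Finset.sum_image fun s _ t _ h => hinj a h]
  refine Finset.sum_congr rfl fun s _ => ?_
  rw [Finset.sum_image fun s _ t _ h => hinj (-a) h]
  refine Finset.sum_congr rfl fun t _ => ?_
  rw [Finsupp.mapDomain_apply (hinj a), Finsupp.mapDomain_apply (hinj (-a))]
  ring_nf

/-- Moving a translation onto the point mass. [folklore] -/
theorem BF_single_U (s a : ℝ) (x : ℝ →₀ ℂ) :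
    BF F (Finsupp.single s 1) (U a x) = BF F (Finsupp.single (s - a) 1) x := by
  have h := BF_U F (-a) (Finsupp.single s 1) x
  rw [neg_neg, U_single, ← sub_eq_add_neg] at h
  exact h.symm

/-- The coefficient `(2iη)⁻¹` is purely imaginary. [folklore] -/
theorem conj_coeffC (η : ℝ) :
    conj (((2 : ℂ) * Complex.I * η)⁻¹) = -((2 : ℂ) * Complex.I * η)⁻¹ := by
  rw [map_inv₀, map_mul, map_mul, Complex.conj_I, Complex.conj_ofReal, map_ofNat,
    show (2 : ℂ) * -Complex.I * η = -(2 * Complex.I * η) by ring, inv_neg]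

/-- `SDOp η` is symmetric for `BF`. [folklore] -/
theorem isSymOp_SDOp (η : ℝ) : IsSymOp (BF F) (SDOp η) := by
  intro x y
  rw [SDOp_apply, SDOp_apply, LinearMap.map_smulₛₗ₂, map_smul, LinearMap.map_sub₂, map_sub, BF_U, BF_U,
    neg_neg, conj_coeffC, smul_eq_mul, smul_eq_mul]
  ring

/-- `SDOp η` acts on the "evaluation functions" `u ↦ BF δ_u x` as `i` times the symmetric
difference quotient. [folklore] -/
theorem BF_single_SDOp {η : ℝ} (hη : η ≠ 0) (s : ℝ) (x : ℝ →₀ ℂ) :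
    BF F (Finsupp.single s 1) (SDOp η x)
      = Complex.I * SD η (fun u => BF F (Finsupp.single u 1) x) s := by
  rw [SDOp_apply, map_smul, map_sub, BF_single_U, BF_single_U, sub_neg_eq_add, SD, smul_eq_mul]
  have hη' : (η : ℂ) ≠ 0 := Complex.ofReal_ne_zero.2 hη
  have hI : ((2 : ℂ) * Complex.I * η)⁻¹ = -Complex.I / (2 * η) := by
    field_simp
    ring_nf
    rw [Complex.I_sq]
    ring
  rw [hI]
  field_simp
  ring

/-- Iterated version of `BF_single_SDOp`. [folklore] -/
theorem BF_single_SDOp_pow {η : ℝ} (hη : η ≠ 0) (N : ℕ) (x : ℝ →₀ ℂ) (s : ℝ) :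
    BF F (Finsupp.single s 1) ((SDOp η ^ N) x)
      = Complex.I ^ N * (SD η)^[N] (fun u => BF F (Finsupp.single u 1) x) s := by
  induction N generalizing s with
  | zero => simp
  | succ N ih =>
    rw [pow_succ', Module.End.mul_apply, BF_single_SDOp F hη, Function.iterate_succ_apply']
    have : (fun u => BF F (Finsupp.single u 1) ((SDOp η ^ N) x))
        = fun u => Complex.I ^ N * (SD η)^[N] (fun u => BF F (Finsupp.single u 1) x) u :=
      funext ih
    rw [this, SD_const_mul]
    ring

variable {F}

/-- The matrix entries `BF δ_s ((SDOp η)^N δ_t)` converge to `(-i)^N F^{(N)}(t - s)` as `η → 0⁺`.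
[folklore] -/
theorem tendsto_BF_single_SDOp_pow (hF : ContDiff ℝ ∞ F) (N : ℕ) (s t : ℝ) {η : ℕ → ℝ}
    (hη : ∀ r, 0 < η r) (hη0 : Tendsto η atTop (𝓝 0)) :
    Tendsto (fun r => BF F (Finsupp.single s 1) ((SDOp (η r) ^ N) (Finsupp.single t 1))) atTop
      (𝓝 ((-Complex.I) ^ N * iteratedDeriv N F (t - s))) := by
  have hg : ContDiff ℝ ∞ (fun u => F (t - u)) := hF.comp (contDiff_const.sub contDiff_id)
  have hDg : iteratedDeriv N (fun u => F (t - u)) s = (-1 : ℂ) ^ N * iteratedDeriv N F (t - s) := by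
    rw [congr_fun (iteratedDeriv_comp_const_sub N F t) s, Complex.real_smul]
    push_cast
    ring
  have hfg : (fun u => BF F (Finsupp.single u 1) (Finsupp.single t 1)) = fun u => F (t - u) :=
    funext fun u => BF_single_single F u t
  have hfun : ∀ r, BF F (Finsupp.single s 1) ((SDOp (η r) ^ N) (Finsupp.single t 1))
      = Complex.I ^ N * (SD (η r))^[N] (fun u => F (t - u)) s := by
    intro r
    rw [BF_single_SDOp_pow F (hη r).ne', hfg]
  simp_rw [hfun]
  have hlim : Tendsto (fun r => (SD (η r))^[N] (fun u => F (t - u)) s) atTop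
      (𝓝 (iteratedDeriv N (fun u => F (t - u)) s)) := by
    rw [Metric.tendsto_atTop]
    intro ε hε
    obtain ⟨δ, hδ, hδ'⟩ := SD_iterate_approx N _ hg s (ε / 2) (half_pos hε)
    have hev : ∀ᶠ r in atTop, η r < δ := (tendsto_order.1 hη0).2 δ hδ
    obtain ⟨R, hR⟩ := eventually_atTop.1 hev
    refine ⟨R, fun r hr => ?_⟩
    rw [dist_eq_norm]
    have := hδ' (η r) s (hη r) (hR r hr) (by simp [hδ])
    linarith
  have := hlim.const_mul (Complex.I ^ N)
  rw [hDg] at this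
  convert this using 2
  rw [neg_pow]
  ring

variable (F)

/-- The form `BF F` has at most `κ` negative squares when all point-mass forms of `F` do.
[folklore] -/
theorem negSqLE_BF (κ : ℕ)
    (H : ∀ (n : ℕ) (x : Fin n → ℝ) (v : Fin (κ + 1) → Fin n → ℂ), ∃ w : Fin (κ + 1) → ℂ, w ≠ 0 ∧
      0 ≤ (∑ k, ∑ l, (∑ i, w i * v i k) * conj (∑ i, w i * v i l) * F (x k - x l)).re) :
    NegSqLE (BF F) κ := by
  classical
  intro u _
  set T : Finset ℝ := Finset.univ.biUnion fun a => (u a).support with hTdef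
  set n : ℕ := T.card with hndef
  set e : Fin n ≃ T := T.equivFin.symm with hedef
  set x : Fin n → ℝ := fun k => (e k : ℝ) with hxdef
  obtain ⟨w, hw, hpos⟩ := H n x (fun a k => u a (x k))
  refine ⟨w, hw, ?_⟩
  set d : ℝ →₀ ℂ := ∑ a, w a • u a with hddef
  have hsupp : d.support ⊆ T := by
    intro s hs
    have hs' := Finsupp.support_finsetSum hs
    rw [Finset.mem_biUnion] at hs'
    rw [hTdef, Finset.mem_biUnion]
    obtain ⟨a, ha, hsa⟩ := hs'
    exact ⟨a, ha, Finsupp.support_smul hsa⟩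
  have hd : ∀ s, d s = ∑ a, w a * u a s := by
    intro s
    rw [hddef, Finsupp.finsetSum_apply]
    simp only [Finsupp.smul_apply, smul_eq_mul]
  rw [BF_apply, kf_eq F hsupp hsupp]
  have h1 : ∀ g : ℝ → ℂ, ∑ t ∈ T, g t = ∑ k : Fin n, g (x k) := by
    intro g
    rw [← Finset.sum_coe_sort T g, ← Equiv.sum_comp e (fun b : T => g (b : ℝ))]
  have key : ∑ s ∈ T, ∑ t ∈ T, conj (d s) * d t * F (t - s)
      = ∑ k, ∑ l, (∑ i, w i * u i (x k)) * conj (∑ i, w i * u i (x l)) * F (x k - x l) := by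
    rw [Finset.sum_comm, h1]
    refine Finset.sum_congr rfl fun k _ => ?_
    rw [h1]
    refine Finset.sum_congr rfl fun l _ => ?_
    rw [hd, hd]
    ring
  rw [key]
  exact hpos

end Form

end Literature.Analysis.OperatorTheory.KreinStewart
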